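import Literature.Analysis.FluidPDE.LocalTypeI
import HarnessLib

/-!
# Weak Serrin implies Type I: the `L^∞`-rate case (Albritton–Barker 2019, Lemma 2.5 with Remark 3.2)

Analysis/FluidPDE named-fact file, companion of `LocalTypeI.lean` (same paper, same vocabulary).
D. Albritton, T. Barker, *On local Type I singularities of the Navier–Stokes equations and Liouville
theorems*, J. Math. Fluid Mech. 21 (2019) = arXiv:1811.00502 (held: paper:arxiv-1811.00502, §2 and
Remark 3.2 read). Bib key `AlbrittonBarker2019`.

**Lemma 2.5** (Weak Serrin implies Type I; verbatim): "If `v` is a suitable weak solution on `Q`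
with `v ∈ L^{q,∞}_t L^{p,∞}_x(Q)`, where `3 ≤ p ≤ ∞` and `2 ≤ q ≤ ∞` satisfy the
Ladyzhenskaya–Prodi–Serrin condition `3/p + 2/q = 1`, then, for all `Q' = Q(R)` with `0 < R < 1`,
`𝐈(Q') < ∞`." Here `Q = Q(1) = Q(0,1)`, `Q(z,r) = B(x,r) × ]t − r², t[` (§2: "We also write
`Q(r) = Q(0,r)` and `Q = Q(1)`"), suitable weak solutions are those of Def. 2.1, and
`𝐈(ω) = sup_{Q' ⊂ ω} (A + C + D + E)(Q')` (§1). **Remark 3.2** (verbatim, the case used here):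
"`sup_{t<0} √(−t) ‖v(·,t)‖_{L^∞} < ∞` alone does not appear to guarantee `𝐈 < ∞` … However, the
forward direction remains valid because Lemma 2.5 implies `𝐈(Q(1/2)) < ∞` (with an estimate
depending on the quantities `C(1)` and `D(1)` for suitable weak solutions)."

**Vendored** as `albrittonBarker2019_lemma_2_5_rate`: the endpoint `(p, q) = (∞, 2)` of Lemma 2.5
for a suitable weak solution in the unit parabolic ball `Q(z, 1)` (tree: `IsSuitableWeakSolutionInBall
1 z u p`, A–B Def. 2.1) whose velocity obeys the Type I RATE `‖u(t', x)‖ ≤ C/√(t − t')` at every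
point of `Q(z,1)` — this pointwise bound puts `t' ↦ ‖u(t')‖_{L^∞(B)}` in `L^{2,∞}(]t−1, t[)` (since
`s ↦ s^{−1/2} ∈ L^{2,∞}(0,1)`), i.e. it is a SPECIAL CASE of the printed hypothesis, so the vendored
statement is weaker than the lemma; conclusion: for every weak spatial gradient `G` of `u` on the
ball and every `0 < R < 1`, `typeIBound (Q(z,R)) u p G < ⊤` (the tree's `𝐈`, `LocalTypeI.lean`).
Translation to a general centre `z` is the paper's convention (all statements are translation
invariant). The general Lorentz-space lemma is not vendored (no `L^{q,∞}_t L^{p,∞}_x` class in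
the tree).

Grounds `Summit.NavierStokesRegularity.NavierStokesRegularity.Theses.DulacContraction.TypeIBlowupProfile`
= route RecurrentProfiles' stmt-NavierStokesRegularity-1591 (step (3) of its text: "the rate is
`L^{2,∞}_t L^∞_x` near `T`, so AlbrittonBarker2019 Lemma 2.5 … gives `𝐈(Q(z,1/2)) < ∞`"), recorded
as 'fact wanted' in that item's grounding note.

## References

* D. Albritton, T. Barker, J. Math. Fluid Mech. 21 (2019) = arXiv:1811.00502: §1 (𝐈, Type I),
  Def. 2.1, **Lemma 2.5**, Lemma 2.6 (Morrey-type estimates, Seregin 2006/07), **Remark 3.2**.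
  [AlbrittonBarker2019]
* G. Seregin, *Estimates of suitable weak solutions to the Navier–Stokes equations in critical
  Morrey spaces*, J. Math. Sci. 143 (2007). [SereginCriticalMorrey2006]
-/

noncomputable section

open MeasureTheory Set Metric
open scoped ENNReal

namespace Literature.Analysis.FluidPDE

/-- Local notation for physical space `ℝ³ = EuclideanSpace ℝ (Fin 3)`. -/
local notation "ℝ³" => EuclideanSpace ℝ (Fin 3)

/-- **Albritton–Barker 2019, Lemma 2.5 (weak Serrin implies Type I), case `(p,q) = (∞,2)` via the
Type I rate (Remark 3.2).** If `(u, p)` is a suitable weak solution of Navier–Stokes (`ν = 1`,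
`f = 0`) in the parabolic ball `Q(z, 1) = ]t−1, t[ × B(x, 1)`, `z = (t, x)`, and
`‖u(t', x')‖ ≤ C/√(t − t')` for all `(t', x') ∈ Q(z, 1)`, then for every weak spatial gradient `G`
of `u` on `Q(z,1)` and every `0 < R < 1` the Albritton–Barker quantity of the smaller ball is
finite: `𝐈(Q(z, R)) < ∞`. [cite: AlbrittonBarker2019, Lemma 2.5 and Remark 3.2 (arXiv:1811.00502 §2, §3)] -/
def albrittonBarker2019_lemma_2_5_rate : Prop :=
  ∀ (z : ℝ × ℝ³) (u : ℝ → ℝ³ → ℝ³) (p : ℝ → ℝ³ → ℝ) (C : ℝ),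
    IsSuitableWeakSolutionInBall 1 z u p →
    (∀ t' x', (t', x') ∈ FluidPDE.parabolicCylinder 1 z → ‖u t' x'‖ ≤ C / Real.sqrt (z.1 - t')) →
    ∀ G : ℝ → ℝ³ → ℝ³ →L[ℝ] ℝ³,
      FluidPDE.HasWeakSpatialGradientOn (FluidPDE.parabolicCylinderOpens 1 z) u G →
      ∀ R : ℝ, 0 < R → R < 1 → typeIBound (FluidPDE.parabolicCylinder R z) u p G < ∞

/-- Under the fact, in particular `𝐈(Q(z, 1/2)) < ∞` — the form quoted in Remark 3.2 and used by
the zoom-in argument of route RecurrentProfiles / DulacContraction (TypeIBlowupProfile). [cite: AlbrittonBarker2019, Remark 3.2] -/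
theorem albrittonBarker2019_lemma_2_5_rate.half (h : albrittonBarker2019_lemma_2_5_rate)
    {z : ℝ × ℝ³} {u : ℝ → ℝ³ → ℝ³} {p : ℝ → ℝ³ → ℝ} {C : ℝ}
    (hsw : IsSuitableWeakSolutionInBall 1 z u p)
    (hrate : ∀ t' x', (t', x') ∈ FluidPDE.parabolicCylinder 1 z → ‖u t' x'‖ ≤ C / Real.sqrt (z.1 - t'))
    {G : ℝ → ℝ³ → ℝ³ →L[ℝ] ℝ³}
    (hG : FluidPDE.HasWeakSpatialGradientOn (FluidPDE.parabolicCylinderOpens 1 z) u G) :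
    typeIBound (FluidPDE.parabolicCylinder (1 / 2) z) u p G < ∞ :=
  h z u p C hsw hrate G hG (1 / 2) (by norm_num) (by norm_num)

end Literature.Analysis.FluidPDE

end
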